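import Mathlib
import Literature.Probability.LatticeModels.HighDimPointwiseTriviality

/-!
# Crux `CriticalTwoPointGSM`, line `Sketch` (canonical-lift spine): the diagonal
# Källén–Lehmann representation

Route `GaussianScaleMixture` of `Ising3DConformalLimit`, crux `CriticalTwoPointGSM`
(stmt-CriticalPhenomena-8365), line `Sketch`, canonical-lift spine (seat c1), stub
`diagConsForm_hausdorff` — the nine-direction dividend of the spine: the quadratic forms of the
critical two-point function `G = ⟨σ₀ σ_·⟩⁺_{β_c}` of the nearest-neighbour Ising model on `ℤ³`
along the DIAGONAL mirror direction `u = e₀ - e₁` are Hausdorff moment sequences.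

Both analytic inputs are HYPOTHESES of the registered statement:

* `hRP` — closed-half-space two-point nine-mirror reflection positivity: for each of the nine
  mirrors `θ'` of `ℤ³` (three coordinate sign changes, three swaps, three anti-swaps) with level
  `ℓ`, every finite family of points `y_a` in the closed half space `ℓ ≥ 0` and real coefficients
  `c_a` satisfy `∑_{a,b} c_a c_b G(y_b - θ' y_a) ≥ 0`;
* `hH` — a bounded real sequence whose Hankel forms at shifts `0` and `1` are positive
  semidefinite is the moment sequence of a finite measure on `[0, 1]` (Hausdorff; Berg–Christensen–
  Ressel 1984).

Fix a finite `s` inside the mirror plane `P = {x : x₀ = x₁}` of the swap `θ' x = x ∘ (0 1)` and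
real `v`, and put `a(N) = ∑_{x,y ∈ s} v_x v_y G(y - x + N u)`. Then:

1. `|a(N)| ≤ (∑ |v_x|)²` from `0 ≤ G ≤ 1`;
2. for `k ∈ ℕ`, the points `y_{(σ,x)} = x + σ u + k e₀` (`σ ∈ S ⊆ ℕ`, `x ∈ s`) lie in the closed
   half space `x₀ - x₁ = 2σ + k ≥ 0`, and since `θ'` fixes `P` pointwise, negates `u` and maps
   `e₀` to `e₁ = e₀ - u`, `y_{(σ',x')} - θ' y_{(σ,x)} = (x' - x) + (σ + σ' + k) u`; so `hRP` with
   coefficients `w_σ v_x` gives `∑_{σ,σ' ∈ S} w_σ w_σ' a(σ + σ' + k) ≥ 0` — the Hankel forms at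
   every shift `k` (used at `k = 0, 1`);
3. `hH` produces the representing measure.

Contents: helpers in `CriticalTwoPointGSMJs.DiagConsFormHausdorff` (the swap instance
`swapRP_finset` of `hRP` over a `Finset`, the lattice identities `pair_diff` / `level_nonneg`, the
shifted Hankel positivity `hankel_nonneg` — steps 2, one parametrised lemma for all shifts `k` —
and the bound `abs_form_le` — step 1), then the registered stub `diagConsForm_hausdorff` (step 3).

References: J. Fröhlich, R. Israel, E. H. Lieb, B. Simon, Comm. Math. Phys. 62 (1978) 1–34
(reflection positivity for the nine mirrors of `ℤ³`, here the hypothesis `hRP`); C. Berg,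
J. P. R. Christensen, P. Ressel, *Harmonic Analysis on Semigroups* (Springer GTM 100, 1984),
Hausdorff's moment theorem in Hankel form (here the hypothesis `hH`). Mathlib: `Finset.sum_product`,
`Finset.sum_coe_sort`, `Finset.sum_comm`, `Finset.mul_sum`, `Finset.sum_mul_sum`,
`Finset.abs_sum_le_sum_abs`, `Equiv.swap_apply_def`, `fin_cases`, `omega`.
-/

namespace Summit.CriticalPhenomena.Ising3DConformalLimit.Theorems

open MeasureTheory Filter Topology
open Literature.Probability.LatticeModels
open scoped BigOperators

noncomputable section

namespace CriticalTwoPointGSMJs.DiagConsFormHausdorff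

/-! ## The swap mirror instance of closed reflection positivity -/

/-- **Closed two-point reflection positivity for the swap mirror `(0 1)`, `Finset` form.** From the
nine-mirror hypothesis `hRP`: for a finite index set `T`, points `y_a` with `(y_a)₀ - (y_a)₁ ≥ 0`
and real `c_a`, `0 ≤ ∑_{a,b ∈ T} c_a c_b G(y_b - y_a ∘ (0 1))`. [folklore] -/
theorem swapRP_finset
    (hRP : ∀ (θ' : Site 3 → Site 3) (ℓ : Site 3 → ℤ),
      (∃ i j : Fin 3, i ≠ j ∧ ((θ' = fun x => Function.update x i (-x i)) ∧ (ℓ = fun x => x i) ∨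
        (θ' = fun x => x ∘ Equiv.swap i j) ∧ (ℓ = fun x => x i - x j) ∨
        (θ' = fun x => Function.update (Function.update x i (-x j)) j (-x i)) ∧ (ℓ = fun x => x i + x j))) →
      ∀ (ι : Type) [Fintype ι] (y : ι → Site 3) (c : ι → ℝ), (∀ a, 0 ≤ ℓ (y a)) →
        0 ≤ ∑ a, ∑ b, c a * c b * criticalTwoPoint 3 (y b - θ' (y a)))
    {ι : Type} (T : Finset ι) (y : ι → Site 3) (c : ι → ℝ) (hy : ∀ a ∈ T, 0 ≤ y a 0 - y a 1) :
    0 ≤ ∑ a ∈ T, ∑ b ∈ T, c a * c b * criticalTwoPoint 3 (y b - y a ∘ Equiv.swap 0 1) := by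
  have h := hRP (fun x => x ∘ Equiv.swap 0 1) (fun x => x 0 - x 1)
    ⟨0, 1, by decide, Or.inr (Or.inl ⟨rfl, rfl⟩)⟩ (↥T) (fun a => y a) (fun a => c a)
    fun a => hy a a.2
  simp only [← Finset.sum_coe_sort T]
  exact h

/-! ## Lattice identities for the swap mirror -/

/-- **Pair differences.** For `x` on the mirror plane (`x₀ = x₁`), `x'` arbitrary and
`σ σ' k ∈ ℕ`, with `u = e₀ - e₁`:
`(x' + σ' u + k e₀) - (x + σ u + k e₀) ∘ (0 1) = (x' - x) + (σ + σ' + k) u`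
(the swap fixes `x`, negates `u` and maps `e₀` to `e₁ = e₀ - u`). [folklore] -/
theorem pair_diff (x x' : Site 3) (hx : x 0 = x 1) (σ σ' k : ℕ) :
    x' + ((σ' : ℕ) : ℤ) • (Pi.single 0 1 - Pi.single 1 1 : Site 3) +
          ((k : ℕ) : ℤ) • (Pi.single 0 1 : Site 3) -
        (x + ((σ : ℕ) : ℤ) • (Pi.single 0 1 - Pi.single 1 1 : Site 3) +
          ((k : ℕ) : ℤ) • (Pi.single 0 1 : Site 3)) ∘ Equiv.swap 0 1 =
      x' - x + ((σ + σ' + k : ℕ) : ℤ) • (Pi.single 0 1 - Pi.single 1 1) := by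
  funext i
  fin_cases i
  · simp
    omega
  · simp
    omega
  · simp [Equiv.swap_apply_def]

/-- **Levels.** For `x` on the mirror plane and `σ k ∈ ℕ`, the point `x + σ u + k e₀` lies in the
closed half space of the swap: `(x + σ u + k e₀)₀ - (x + σ u + k e₀)₁ = 2σ + k ≥ 0`. [folklore] -/
theorem level_nonneg (x : Site 3) (hx : x 0 = x 1) (σ k : ℕ) :
    0 ≤ (x + ((σ : ℕ) : ℤ) • (Pi.single 0 1 - Pi.single 1 1 : Site 3) +
          ((k : ℕ) : ℤ) • (Pi.single 0 1 : Site 3)) 0 -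
        (x + ((σ : ℕ) : ℤ) • (Pi.single 0 1 - Pi.single 1 1 : Site 3) +
          ((k : ℕ) : ℤ) • (Pi.single 0 1 : Site 3)) 1 := by
  simp
  omega

/-! ## The shifted Hankel forms are positive semidefinite -/

/-- **Hankel positivity at every shift.** Given `hRP`, for finite `s` on the mirror plane, real
`v`, a shift `k ∈ ℕ`, finite `S ⊆ ℕ` and real `w`:
`0 ≤ ∑_{σ,τ ∈ S} w_σ w_τ ∑_{x,y ∈ s} v_x v_y G(y - x + (σ + τ + k) u)` — reflection positivity for
the points `x + σ u + k e₀` with coefficients `w_σ v_x`. [folklore] -/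
theorem hankel_nonneg
    (hRP : ∀ (θ' : Site 3 → Site 3) (ℓ : Site 3 → ℤ),
      (∃ i j : Fin 3, i ≠ j ∧ ((θ' = fun x => Function.update x i (-x i)) ∧ (ℓ = fun x => x i) ∨
        (θ' = fun x => x ∘ Equiv.swap i j) ∧ (ℓ = fun x => x i - x j) ∨
        (θ' = fun x => Function.update (Function.update x i (-x j)) j (-x i)) ∧ (ℓ = fun x => x i + x j))) →
      ∀ (ι : Type) [Fintype ι] (y : ι → Site 3) (c : ι → ℝ), (∀ a, 0 ≤ ℓ (y a)) →
        0 ≤ ∑ a, ∑ b, c a * c b * criticalTwoPoint 3 (y b - θ' (y a)))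
    (s : Finset (Site 3)) (hs : ∀ x ∈ s, x 0 = x 1) (v : Site 3 → ℝ) (k : ℕ) (S : Finset ℕ)
    (w : ℕ → ℝ) :
    0 ≤ ∑ σ ∈ S, ∑ τ ∈ S, w σ * w τ * ∑ x ∈ s, ∑ y ∈ s, v x * v y *
      criticalTwoPoint 3 (y - x + ((σ + τ + k : ℕ) : ℤ) • (Pi.single 0 1 - Pi.single 1 1)) := by
  have h := swapRP_finset hRP (S ×ˢ s)
    (fun p => p.2 + ((p.1 : ℕ) : ℤ) • (Pi.single 0 1 - Pi.single 1 1 : Site 3) +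
      ((k : ℕ) : ℤ) • (Pi.single 0 1 : Site 3))
    (fun p => w p.1 * v p.2)
    (fun p hp => level_nonneg p.2 (hs p.2 (Finset.mem_product.1 hp).2) p.1 k)
  simp only [Finset.sum_product] at h
  refine h.trans_eq ?_
  refine Finset.sum_congr rfl fun σ _ => ?_
  rw [Finset.sum_comm]
  refine Finset.sum_congr rfl fun τ _ => ?_
  rw [Finset.mul_sum]
  refine Finset.sum_congr rfl fun x hx => ?_
  rw [Finset.mul_sum]
  refine Finset.sum_congr rfl fun y _ => ?_
  rw [pair_diff x y (hs x hx) σ τ k]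
  ring

/-! ## Boundedness -/

/-- **Bound.** `|∑_{x,y ∈ s} v_x v_y G(y - x + z)| ≤ (∑_{x ∈ s} |v_x|)²`, from `0 ≤ G ≤ 1`
(Griffiths). [folklore] -/
theorem abs_form_le (s : Finset (Site 3)) (v : Site 3 → ℝ) (z : Site 3) :
    |∑ x ∈ s, ∑ y ∈ s, v x * v y * criticalTwoPoint 3 (y - x + z)| ≤
      (∑ x ∈ s, |v x|) * ∑ x ∈ s, |v x| := by
  calc |∑ x ∈ s, ∑ y ∈ s, v x * v y * criticalTwoPoint 3 (y - x + z)|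
      ≤ ∑ x ∈ s, |∑ y ∈ s, v x * v y * criticalTwoPoint 3 (y - x + z)| :=
        Finset.abs_sum_le_sum_abs _ _
    _ ≤ ∑ x ∈ s, ∑ y ∈ s, |v x * v y * criticalTwoPoint 3 (y - x + z)| :=
        Finset.sum_le_sum fun x _ => Finset.abs_sum_le_sum_abs _ _
    _ ≤ ∑ x ∈ s, ∑ y ∈ s, |v x| * |v y| :=
        Finset.sum_le_sum fun x _ => Finset.sum_le_sum fun y _ => by
          rw [abs_mul, abs_mul, abs_of_nonneg (criticalTwoPoint_nonneg' _)]
          exact mul_le_of_le_one_right (by positivity) (criticalTwoPoint_le_one' _)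
    _ = (∑ x ∈ s, |v x|) * ∑ x ∈ s, |v x| := (Finset.sum_mul_sum _ _ _ _).symm

end CriticalTwoPointGSMJs.DiagConsFormHausdorff

/-- **STUB `diagConsForm_hausdorff` (diagonal Källén–Lehmann representation).** Given closed
two-point nine-mirror reflection positivity (`hRP`) and the Hankel-to-Hausdorff moment theorem
(`hH`): for every finite `s` in the mirror plane `{x₀ = x₁}` and real `v` there is a finite measure
`μ` on `[0, 1]` with `∑_{x,y ∈ s} v_x v_y ⟨σ_x σ_{y + N(e₀ - e₁)}⟩_{β_c} = ∫ t^N dμ` for all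
`N ∈ ℕ` — the swap-mirror quadratic forms of the critical two-point function along the diagonal
`u = e₀ - e₁` are Hausdorff moment sequences. [folklore] -/
theorem diagConsForm_hausdorff
    (hRP : ∀ (θ' : Site 3 → Site 3) (ℓ : Site 3 → ℤ),
      (∃ i j : Fin 3, i ≠ j ∧ ((θ' = fun x => Function.update x i (-x i)) ∧ (ℓ = fun x => x i) ∨
        (θ' = fun x => x ∘ Equiv.swap i j) ∧ (ℓ = fun x => x i - x j) ∨
        (θ' = fun x => Function.update (Function.update x i (-x j)) j (-x i)) ∧ (ℓ = fun x => x i + x j))) →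
      ∀ (ι : Type) [Fintype ι] (y : ι → Site 3) (c : ι → ℝ), (∀ a, 0 ≤ ℓ (y a)) →
        0 ≤ ∑ a, ∑ b, c a * c b * criticalTwoPoint 3 (y b - θ' (y a)))
    (hH : ∀ a : ℕ → ℝ, (∃ C : ℝ, ∀ n, |a n| ≤ C) →
      (∀ (s : Finset ℕ) (c : ℕ → ℝ), 0 ≤ ∑ i ∈ s, ∑ j ∈ s, c i * c j * a (i + j)) →
      (∀ (s : Finset ℕ) (c : ℕ → ℝ), 0 ≤ ∑ i ∈ s, ∑ j ∈ s, c i * c j * a (i + j + 1)) →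
      ∃ μ : Measure ℝ, IsFiniteMeasure μ ∧ μ (Set.Icc (0 : ℝ) 1)ᶜ = 0 ∧ ∀ n : ℕ, a n = ∫ t, t ^ n ∂μ) :
    ∀ (s : Finset (Site 3)), (∀ x ∈ s, x 0 = x 1) → ∀ (v : Site 3 → ℝ),
      ∃ μ : Measure ℝ, IsFiniteMeasure μ ∧ μ (Set.Icc (0 : ℝ) 1)ᶜ = 0 ∧
        ∀ N : ℕ, ∑ x ∈ s, ∑ y ∈ s, v x * v y *
          criticalTwoPoint 3 (y - x + (N : ℤ) • (Pi.single 0 1 - Pi.single 1 1)) = ∫ t, t ^ N ∂μ := by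
  intro s hs v
  have hb : ∃ C : ℝ, ∀ N : ℕ, |∑ x ∈ s, ∑ y ∈ s, v x * v y *
      criticalTwoPoint 3 (y - x + (N : ℤ) • (Pi.single 0 1 - Pi.single 1 1))| ≤ C :=
    ⟨(∑ x ∈ s, |v x|) * ∑ x ∈ s, |v x|, fun N =>
      CriticalTwoPointGSMJs.DiagConsFormHausdorff.abs_form_le s v _⟩
  have h0 : ∀ (S : Finset ℕ) (c : ℕ → ℝ), 0 ≤ ∑ i ∈ S, ∑ j ∈ S, c i * c j *
      ∑ x ∈ s, ∑ y ∈ s, v x * v y *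
        criticalTwoPoint 3 (y - x + ((i + j : ℕ) : ℤ) • (Pi.single 0 1 - Pi.single 1 1)) :=
    fun S c => by
      simpa only [add_zero] using
        CriticalTwoPointGSMJs.DiagConsFormHausdorff.hankel_nonneg hRP s hs v 0 S c
  have h1 : ∀ (S : Finset ℕ) (c : ℕ → ℝ), 0 ≤ ∑ i ∈ S, ∑ j ∈ S, c i * c j *
      ∑ x ∈ s, ∑ y ∈ s, v x * v y *
        criticalTwoPoint 3 (y - x + ((i + j + 1 : ℕ) : ℤ) • (Pi.single 0 1 - Pi.single 1 1)) :=
    fun S c => CriticalTwoPointGSMJs.DiagConsFormHausdorff.hankel_nonneg hRP s hs v 1 S c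
  exact hH (fun N => ∑ x ∈ s, ∑ y ∈ s, v x * v y *
    criticalTwoPoint 3 (y - x + (N : ℤ) • (Pi.single 0 1 - Pi.single 1 1))) hb h0 h1

end

end Summit.CriticalPhenomena.Ising3DConformalLimit.Theorems
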